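/-
Copyright (c) 2026 the pub-hodgecm-mathlib formalisation cell (harness21).  Prover seat hodgecm-mathlib-K2E3-p03 (g4), Track B «K2-LIT» ∕ h413
(`stmt-HodgeConjecture-24833`), line `K2_E3_EllipticInputs`, unit U12, road «GL-[M6]-sc» (line lead K2E3-p23 (g5), deal (M11-2); census K2E3-p17 (g6)),
brick B4-1m, FILE 1 OF 3: THE OPEN-CLOSED FUNDAMENTAL DOMAIN `D = {g | v(det g) ∈ {1, q⁻¹, q⁻²}}` OF `ϖ^ℤ·1` IN `GL₃(F)` — THE INTEGER HEIGHT `h(g) = log_q⁻¹ v(det g)`,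
UNIQUE REPRESENTATIVES, `D` CLOPEN, `mk|_D : D → G' = GL₃(F) ⧸ ϖ^ℤ·1` A HOMEOMORPHISM.  2026-09-04.
-/
import Summits.HodgeConjecture.HodgeConjecture.Theorems.K2E3GL3ModUniformizerCentralizerTrichotomy   -- ★ B4-1d file 1 (this seat): the `G'` frame; brings ★ B0a `normal_map_scalar`, ★ GL-P frame
import Summits.HodgeConjecture.HodgeConjecture.Theorems.K2E3GL3ModUniformizerCocompact               -- ★ B0z (K2E3-p23): `v_units_zpow_uniformizer`
import HarnessLib

/-!
# K2_E3 road (h413), road «GL-[M6]-sc», brick B4-1m (file 1 of 3) — the fundamental domain `D` of `ϖ^ℤ·1` in `GL₃(F)` and `D ≃ₜ G'`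

Cell `pub/hodgecm-mathlib` (D-0151), Track B (21-frontier RULING «PUSH BOTH» 2026-09-03, director req624), seat K2E3-p03 (g4); by-name deal (M11-2) of the
line lead K2E3-p23 (g5), squad bus 2026-09-04T06:52:23Z, on the census (i)–(v) of K2E3-p17 (g6) 06:47:03Z.  `--supports stmt-HodgeConjecture-24833 --as helper`;
THEOREMS ONLY (no definition ∕ instance ∕ notation ∕ named fact ∕ `sorry`); never imports `Cruxes/…/Lines`.  COUNT-NEUTRAL.

Throughout `G' := GL (Fin 3) F ⧸ N'`, `N' := (Subgroup.zpowers (Units.mk0 ϖ hϖ0)).map (Matrix.GeneralLinearGroup.scalar (Fin 3))` (spelled out), with the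
INTEGER HEIGHT `h g := WithZero.log (Valued.v (det g)) ∈ ℤ` (so `v(det g) = exp (h g)`; `h(ϖ^k·g) = h g − 3k`, `h(x g) = h x + h g`) and the window
`D := {g | h g ∈ [−2, 0]}` (spelled out as a set-builder; no `def`).

THE RESULTS.  §1 (`[Valued F ℤᵐ⁰]`, algebra): `v_det_ne_zero`, `exp_log_v_det`, `log_v_det_mul`, `log_v_det_scalar_zpow`, **`log_v_det_scalar_zpow_mul`**
(`h(ϖ^k·1 · g) = h g − 3k`), `mk_scalar_zpow_mul` (`mk (ϖ^k·g) = mk g`), **`exists_log_v_det_scalar_zpow_mul_mem_Icc`** (every `g` has a translate `ϖ^k·g ∈ D`,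
`k = ⌊(h g + 2)∕3⌋`), `zpow_eq_of_log_mem_Icc` (that `k` is unique), **`eq_of_mk_eq_of_log_mem_Icc`** (`mk` is injective on `D`), **`exists_mk_eq_of_log_mem_Icc`**
(`mk|_D` is onto `G'`), `preimage_scalar_zpow_mul_setOf_log_eq` ∕ `preimage_mul_setOf_log_mem` (how left translations move the level sets `{h = i}` and windows).
§2 (`F` a non-archimedean local field, ★ GL-P frame): `isClopen_setOf_v_eq_one`, `isOpen_setOf_v_det_eq_exp`, **`isLocallyConstant_log_v_det`** ∕
`continuous_log_v_det` (the height is locally constant), **`isClopen_preimage_log_v_det`** (every `h⁻¹(S)` — in particular `D` and every level set — is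
clopen), **`exists_homeomorph_fundDomain`** (`∃ e : ↥D ≃ₜ G', ∀ g, e g = mk g`: a continuous open bijection), **`isCompact_inter_preimage_mk`** (`D ∩ mk⁻¹ K`
is compact for `K ⊆ G'` compact), `image_mk_fundDomain_eq_univ`.
Files 2–3 (`K2E3GL3ModUniformizerHaarTransfer`, `…SeparableAE`): `(μ|_D).map mk` is a Haar measure of `G'`, the a.e.-transfer `GL₃(F) → G'`, and
«a.e. `x ∈ G'` has a regular semisimple lift».  [Cartier1979, §I.3–I.4 (the groups `G ∕ ϖ^ℤ`); HarishChandra1970, Part VII §3 p. 70 (working modulo a discrete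
cocompact central subgroup); WeilIntegration1965, §7–§8]
HONEST LABEL: HC_CM is proved only modulo the 7 printed citations (2 remaining named inputs: hLiu418 = stmt-HodgeConjecture-24832, h413 =
stmt-HodgeConjecture-24833) until rung 0 closes; count-neutral helper.

## References
* [Cartier1979] P. Cartier, *Representations of p-adic groups: a survey*, Corvallis (1979), §I.3–I.4.
* [HarishChandra1970] Harish-Chandra (notes by G. van Dijk), *Harmonic Analysis on Reductive p-adic Groups*, LNM 162 (1970), Part VII §3.
* [WeilIntegration1965] A. Weil, *L'intégration dans les groupes topologiques et ses applications*, 2e éd. (1965), §7–§8.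
-/

set_option autoImplicit false
set_option linter.dupNamespace false   -- `Summit.HodgeConjecture.HodgeConjecture.…` (D-0017 nested layout; lakefile exemption for Summits)

noncomputable section

open Topology
open scoped Matrix MatrixGroups WithZero
open Summit.HodgeConjecture.HodgeConjecture.Cruxes.H413.K2E3GL3ModUniformizerCocompact

namespace Summit.HodgeConjecture.HodgeConjecture.Cruxes.H413.K2E3GL3ModUniformizerFundamentalDomain

/-! ## §1  The integer height `h(g) = log v(det g)` and the representatives `ϖ^k·g ∈ D` -/

section Height

variable {F : Type*} [Field F]

/-- `mk (ϖ^k·g) = mk g` in `G'`. [folklore] -/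
theorem mk_scalar_zpow_mul {ϖ : F} (hϖ0 : ϖ ≠ 0)
    [((Subgroup.zpowers (Units.mk0 ϖ hϖ0)).map (Matrix.GeneralLinearGroup.scalar (Fin 3))).Normal] (k : ℤ) (g : GL (Fin 3) F) :
    (QuotientGroup.mk (Matrix.GeneralLinearGroup.scalar (Fin 3) (Units.mk0 ϖ hϖ0 ^ k) * g) :
        GL (Fin 3) F ⧸ (Subgroup.zpowers (Units.mk0 ϖ hϖ0)).map (Matrix.GeneralLinearGroup.scalar (Fin 3))) = QuotientGroup.mk g := by
  rw [QuotientGroup.mk_mul, (QuotientGroup.eq_one_iff _).2 (Subgroup.mem_map_of_mem _ (Subgroup.zpow_mem _ (Subgroup.mem_zpowers _) k)), one_mul]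

variable [Valued F ℤᵐ⁰]

/-- `v(det g) ≠ 0` for `g ∈ GL₃(F)`. [folklore] -/
theorem v_det_ne_zero (g : GL (Fin 3) F) : Valued.v (g : Matrix (Fin 3) (Fin 3) F).det ≠ 0 :=
  (Valuation.ne_zero_iff _).2 (Matrix.GeneralLinearGroup.det_ne_zero g)

/-- `v(det g) = exp (h g)`. [folklore] -/
theorem exp_log_v_det (g : GL (Fin 3) F) :
    WithZero.exp (WithZero.log (Valued.v (g : Matrix (Fin 3) (Fin 3) F).det)) = Valued.v (g : Matrix (Fin 3) (Fin 3) F).det :=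
  WithZero.exp_log (v_det_ne_zero g)

/-- `h(x g) = h x + h g`. [folklore] -/
theorem log_v_det_mul (x g : GL (Fin 3) F) :
    WithZero.log (Valued.v ((x * g : GL (Fin 3) F) : Matrix (Fin 3) (Fin 3) F).det) =
      WithZero.log (Valued.v (x : Matrix (Fin 3) (Fin 3) F).det) + WithZero.log (Valued.v (g : Matrix (Fin 3) (Fin 3) F).det) := by
  rw [Units.val_mul, Matrix.det_mul, map_mul, WithZero.log_mul (v_det_ne_zero x) (v_det_ne_zero g)]

/-- `h(ϖ^k·1) = −3k`. [folklore] -/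
theorem log_v_det_scalar_zpow {ϖ : F} (hϖ : Valued.v ϖ = WithZero.exp (-1 : ℤ)) (hϖ0 : ϖ ≠ 0) (k : ℤ) :
    WithZero.log (Valued.v ((Matrix.GeneralLinearGroup.scalar (Fin 3) (Units.mk0 ϖ hϖ0 ^ k) : GL (Fin 3) F) : Matrix (Fin 3) (Fin 3) F).det) = -(3 * k) := by
  rw [Matrix.GeneralLinearGroup.coe_scalar, Matrix.scalar_apply, Matrix.det_diagonal, Finset.prod_const, Finset.card_univ, Fintype.card_fin,
    ← Units.val_pow_eq_pow_val, ← zpow_natCast, ← zpow_mul, v_units_zpow_uniformizer hϖ hϖ0, WithZero.log_exp]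
  push_cast
  ring

/-- **`h(ϖ^k·g) = h g − 3k`.** [folklore] -/
theorem log_v_det_scalar_zpow_mul {ϖ : F} (hϖ : Valued.v ϖ = WithZero.exp (-1 : ℤ)) (hϖ0 : ϖ ≠ 0) (k : ℤ) (g : GL (Fin 3) F) :
    WithZero.log (Valued.v ((Matrix.GeneralLinearGroup.scalar (Fin 3) (Units.mk0 ϖ hϖ0 ^ k) * g : GL (Fin 3) F) : Matrix (Fin 3) (Fin 3) F).det) =
      WithZero.log (Valued.v (g : Matrix (Fin 3) (Fin 3) F).det) - 3 * k := by
  rw [log_v_det_mul, log_v_det_scalar_zpow hϖ hϖ0]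
  ring

/-- **Every `g` has a translate `ϖ^k·g` in the window `D = {h ∈ [−2, 0]}`** (`k = ⌊(h g + 2)∕3⌋`). [cite: Cartier1979, §I.3] -/
theorem exists_log_v_det_scalar_zpow_mul_mem_Icc {ϖ : F} (hϖ : Valued.v ϖ = WithZero.exp (-1 : ℤ)) (hϖ0 : ϖ ≠ 0) (g : GL (Fin 3) F) :
    ∃ k : ℤ, WithZero.log (Valued.v ((Matrix.GeneralLinearGroup.scalar (Fin 3) (Units.mk0 ϖ hϖ0 ^ k) * g : GL (Fin 3) F) : Matrix (Fin 3) (Fin 3) F).det) ∈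
      Set.Icc (-2 : ℤ) 0 := by
  refine ⟨(WithZero.log (Valued.v (g : Matrix (Fin 3) (Fin 3) F).det) + 2) / 3, ?_⟩
  rw [log_v_det_scalar_zpow_mul hϖ hϖ0, Set.mem_Icc]
  omega

/-- The exponent `k` with `ϖ^k·g ∈ D` is unique. [cite: Cartier1979, §I.3] -/
theorem zpow_eq_of_log_mem_Icc {ϖ : F} (hϖ : Valued.v ϖ = WithZero.exp (-1 : ℤ)) (hϖ0 : ϖ ≠ 0) (g : GL (Fin 3) F) {k k' : ℤ}
    (hk : WithZero.log (Valued.v ((Matrix.GeneralLinearGroup.scalar (Fin 3) (Units.mk0 ϖ hϖ0 ^ k) * g : GL (Fin 3) F) : Matrix (Fin 3) (Fin 3) F).det) ∈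
      Set.Icc (-2 : ℤ) 0)
    (hk' : WithZero.log (Valued.v ((Matrix.GeneralLinearGroup.scalar (Fin 3) (Units.mk0 ϖ hϖ0 ^ k') * g : GL (Fin 3) F) : Matrix (Fin 3) (Fin 3) F).det) ∈
      Set.Icc (-2 : ℤ) 0) : k = k' := by
  rw [log_v_det_scalar_zpow_mul hϖ hϖ0, Set.mem_Icc] at hk hk'
  omega

/-- **`mk` is injective on `D`**: two elements of the window with the same image in `G'` are equal. [cite: Cartier1979, §I.3] -/
theorem eq_of_mk_eq_of_log_mem_Icc {ϖ : F} (hϖ : Valued.v ϖ = WithZero.exp (-1 : ℤ)) (hϖ0 : ϖ ≠ 0)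
    [((Subgroup.zpowers (Units.mk0 ϖ hϖ0)).map (Matrix.GeneralLinearGroup.scalar (Fin 3))).Normal] {g g' : GL (Fin 3) F}
    (hg : WithZero.log (Valued.v (g : Matrix (Fin 3) (Fin 3) F).det) ∈ Set.Icc (-2 : ℤ) 0)
    (hg' : WithZero.log (Valued.v (g' : Matrix (Fin 3) (Fin 3) F).det) ∈ Set.Icc (-2 : ℤ) 0)
    (h : (QuotientGroup.mk g : GL (Fin 3) F ⧸ (Subgroup.zpowers (Units.mk0 ϖ hϖ0)).map (Matrix.GeneralLinearGroup.scalar (Fin 3))) = QuotientGroup.mk g') :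
    g = g' := by
  rw [QuotientGroup.eq] at h
  obtain ⟨c, hc, hs⟩ := Subgroup.mem_map.1 h
  obtain ⟨k, rfl⟩ := Subgroup.mem_zpowers_iff.1 hc
  have hg'eq : g' = Matrix.GeneralLinearGroup.scalar (Fin 3) (Units.mk0 ϖ hϖ0 ^ k) * g := by
    rw [Matrix.GeneralLinearGroup.scalar_commute, hs, mul_inv_cancel_left]
  rw [hg'eq, log_v_det_scalar_zpow_mul hϖ hϖ0, Set.mem_Icc] at hg'
  rw [Set.mem_Icc] at hg
  have hk0 : k = 0 := by omega
  rw [hg'eq, hk0, zpow_zero, map_one, one_mul]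

/-- **`mk|_D` is onto `G'`**: every class has a representative in the window. [cite: Cartier1979, §I.3] -/
theorem exists_mk_eq_of_log_mem_Icc {ϖ : F} (hϖ : Valued.v ϖ = WithZero.exp (-1 : ℤ)) (hϖ0 : ϖ ≠ 0)
    [((Subgroup.zpowers (Units.mk0 ϖ hϖ0)).map (Matrix.GeneralLinearGroup.scalar (Fin 3))).Normal]
    (x : GL (Fin 3) F ⧸ (Subgroup.zpowers (Units.mk0 ϖ hϖ0)).map (Matrix.GeneralLinearGroup.scalar (Fin 3))) :
    ∃ g : GL (Fin 3) F, WithZero.log (Valued.v (g : Matrix (Fin 3) (Fin 3) F).det) ∈ Set.Icc (-2 : ℤ) 0 ∧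
      (QuotientGroup.mk g : GL (Fin 3) F ⧸ (Subgroup.zpowers (Units.mk0 ϖ hϖ0)).map (Matrix.GeneralLinearGroup.scalar (Fin 3))) = x := by
  obtain ⟨g₀, rfl⟩ := QuotientGroup.mk_surjective x
  obtain ⟨k, hk⟩ := exists_log_v_det_scalar_zpow_mul_mem_Icc hϖ hϖ0 g₀
  exact ⟨_, hk, mk_scalar_zpow_mul hϖ0 k g₀⟩

/-- `mk(D) = G'`. [cite: Cartier1979, §I.3] -/
theorem image_mk_fundDomain_eq_univ {ϖ : F} (hϖ : Valued.v ϖ = WithZero.exp (-1 : ℤ)) (hϖ0 : ϖ ≠ 0)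
    [((Subgroup.zpowers (Units.mk0 ϖ hϖ0)).map (Matrix.GeneralLinearGroup.scalar (Fin 3))).Normal] :
    (QuotientGroup.mk : GL (Fin 3) F → GL (Fin 3) F ⧸ (Subgroup.zpowers (Units.mk0 ϖ hϖ0)).map (Matrix.GeneralLinearGroup.scalar (Fin 3))) ''
        {g : GL (Fin 3) F | WithZero.log (Valued.v (g : Matrix (Fin 3) (Fin 3) F).det) ∈ Set.Icc (-2 : ℤ) 0} = Set.univ := by
  refine Set.eq_univ_of_forall fun x => ?_
  obtain ⟨g, hg, hx⟩ := exists_mk_eq_of_log_mem_Icc hϖ hϖ0 x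
  exact ⟨g, hg, hx⟩

/-- Left translation by `ϖ^k·1` moves the level set `{h = i}` to `{h = i + 3k}` (as a preimage). [folklore] -/
theorem preimage_scalar_zpow_mul_setOf_log_eq {ϖ : F} (hϖ : Valued.v ϖ = WithZero.exp (-1 : ℤ)) (hϖ0 : ϖ ≠ 0) (k i : ℤ) :
    (fun g : GL (Fin 3) F => Matrix.GeneralLinearGroup.scalar (Fin 3) (Units.mk0 ϖ hϖ0 ^ k) * g) ⁻¹'
        {g : GL (Fin 3) F | WithZero.log (Valued.v (g : Matrix (Fin 3) (Fin 3) F).det) = i} =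
      {g : GL (Fin 3) F | WithZero.log (Valued.v (g : Matrix (Fin 3) (Fin 3) F).det) = i + 3 * k} := by
  ext g
  simp only [Set.mem_preimage, Set.mem_setOf_eq, log_v_det_scalar_zpow_mul hϖ hϖ0]
  omega

/-- Left translation by `x` moves the window `{h ∈ S}` to `{h x + h ∈ S}` (as a preimage). [folklore] -/
theorem preimage_mul_setOf_log_mem (x : GL (Fin 3) F) (S : Set ℤ) :
    (fun g : GL (Fin 3) F => x * g) ⁻¹' {g : GL (Fin 3) F | WithZero.log (Valued.v (g : Matrix (Fin 3) (Fin 3) F).det) ∈ S} =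
      {g : GL (Fin 3) F | WithZero.log (Valued.v (x : Matrix (Fin 3) (Fin 3) F).det) + WithZero.log (Valued.v (g : Matrix (Fin 3) (Fin 3) F).det) ∈ S} := by
  ext g
  simp only [Set.mem_preimage, Set.mem_setOf_eq, log_v_det_mul]

end Height

/-! ## §2  Topology: the height is locally constant, `D` is clopen, `mk|_D : D ≃ₜ G'` -/

section Topology

variable {F : Type*} [Field F] [Valued F ℤᵐ⁰] [ValuativeRel F] [(Valued.v : Valuation F ℤᵐ⁰).Compatible] [IsNonarchimedeanLocalField F]

/-- The unit sphere `{v = 1}` is clopen. [folklore] -/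
theorem isClopen_setOf_v_eq_one : IsClopen {x : F | Valued.v x = 1} := by
  have h := Valuation.isClopen_sphere (v := (Valued.v : Valuation F ℤᵐ⁰)) (r := 1) one_ne_zero
  simp only [Valuation.restrict_eq_one_iff] at h
  exact h

/-- The level set `{g | v(det g) = exp i}` is open in `GL₃(F)`. [folklore] -/
theorem isOpen_setOf_v_det_eq_exp {ϖ : F} (hϖ : Valued.v ϖ = WithZero.exp (-1 : ℤ)) (i : ℤ) :
    IsOpen {g : GL (Fin 3) F | Valued.v (g : Matrix (Fin 3) (Fin 3) F).det = WithZero.exp i} := by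
  have h : {g : GL (Fin 3) F | Valued.v (g : Matrix (Fin 3) (Fin 3) F).det = WithZero.exp i} =
      (fun g : GL (Fin 3) F => ϖ ^ i * (g : Matrix (Fin 3) (Fin 3) F).det) ⁻¹' {x : F | Valued.v x = 1} := by
    ext g
    simp only [Set.mem_setOf_eq, Set.mem_preimage, map_mul, map_zpow₀, hϖ, ← WithZero.exp_zsmul, smul_eq_mul, mul_neg, mul_one]
    rw [← exp_log_v_det g, WithZero.exp_inj, ← WithZero.exp_add, ← WithZero.exp_zero, WithZero.exp_inj]
    omega
  rw [h]
  exact isClopen_setOf_v_eq_one.isOpen.preimage (continuous_const.mul (Units.continuous_val.matrix_det))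

/-- **The height `g ↦ log v(det g) : GL₃(F) → ℤ` is locally constant.** [cite: Cartier1979, §I.3] -/
theorem isLocallyConstant_log_v_det {ϖ : F} (hϖ : Valued.v ϖ = WithZero.exp (-1 : ℤ)) :
    IsLocallyConstant fun g : GL (Fin 3) F => WithZero.log (Valued.v (g : Matrix (Fin 3) (Fin 3) F).det) := by
  refine IsLocallyConstant.iff_isOpen_fiber.2 fun i => ?_
  have h : (fun g : GL (Fin 3) F => WithZero.log (Valued.v (g : Matrix (Fin 3) (Fin 3) F).det)) ⁻¹' {i} =
      {g : GL (Fin 3) F | Valued.v (g : Matrix (Fin 3) (Fin 3) F).det = WithZero.exp i} := by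
    ext g
    simp only [Set.mem_preimage, Set.mem_singleton_iff, Set.mem_setOf_eq]
    constructor
    · intro hg
      rw [← hg, exp_log_v_det]
    · intro hg
      rw [hg, WithZero.log_exp]
  rw [h]
  exact isOpen_setOf_v_det_eq_exp hϖ i

/-- The height is continuous (`ℤ` discrete). [folklore] -/
theorem continuous_log_v_det {ϖ : F} (hϖ : Valued.v ϖ = WithZero.exp (-1 : ℤ)) :
    Continuous fun g : GL (Fin 3) F => WithZero.log (Valued.v (g : Matrix (Fin 3) (Fin 3) F).det) :=
  (isLocallyConstant_log_v_det hϖ).continuous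

/-- **Every height window `h⁻¹(S)` is clopen** — in particular `D = h⁻¹[−2, 0]` and every level set `h⁻¹{i}`. [cite: Cartier1979, §I.3] -/
theorem isClopen_preimage_log_v_det {ϖ : F} (hϖ : Valued.v ϖ = WithZero.exp (-1 : ℤ)) (S : Set ℤ) :
    IsClopen {g : GL (Fin 3) F | WithZero.log (Valued.v (g : Matrix (Fin 3) (Fin 3) F).det) ∈ S} :=
  (isClopen_discrete S).preimage (continuous_log_v_det hϖ)

/-- **`mk|_D : D → G'` is a homeomorphism** (a continuous open bijection: injective by `eq_of_mk_eq_of_log_mem_Icc`, surjective by `exists_mk_eq_of_log_mem_Icc`,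
open since `D` is open and `mk` is an open map). [cite: Cartier1979, §I.3–I.4; cite: WeilIntegration1965, §7] -/
theorem exists_homeomorph_fundDomain {ϖ : F} (hϖ : Valued.v ϖ = WithZero.exp (-1 : ℤ)) (hϖ0 : ϖ ≠ 0)
    [((Subgroup.zpowers (Units.mk0 ϖ hϖ0)).map (Matrix.GeneralLinearGroup.scalar (Fin 3))).Normal] :
    ∃ e : {g : GL (Fin 3) F | WithZero.log (Valued.v (g : Matrix (Fin 3) (Fin 3) F).det) ∈ Set.Icc (-2 : ℤ) 0} ≃ₜ
        GL (Fin 3) F ⧸ (Subgroup.zpowers (Units.mk0 ϖ hϖ0)).map (Matrix.GeneralLinearGroup.scalar (Fin 3)),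
      ∀ g, e g = QuotientGroup.mk (g : GL (Fin 3) F) := by
  have hbij : Function.Bijective fun g : {g : GL (Fin 3) F | WithZero.log (Valued.v (g : Matrix (Fin 3) (Fin 3) F).det) ∈ Set.Icc (-2 : ℤ) 0} =>
      (QuotientGroup.mk (g : GL (Fin 3) F) : GL (Fin 3) F ⧸ (Subgroup.zpowers (Units.mk0 ϖ hϖ0)).map (Matrix.GeneralLinearGroup.scalar (Fin 3))) := by
    refine ⟨fun a b h => Subtype.ext (eq_of_mk_eq_of_log_mem_Icc hϖ hϖ0 a.2 b.2 h), fun x => ?_⟩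
    obtain ⟨g, hg, hx⟩ := exists_mk_eq_of_log_mem_Icc hϖ hϖ0 x
    exact ⟨⟨g, hg⟩, hx⟩
  have hcont : Continuous fun g : {g : GL (Fin 3) F | WithZero.log (Valued.v (g : Matrix (Fin 3) (Fin 3) F).det) ∈ Set.Icc (-2 : ℤ) 0} =>
      (QuotientGroup.mk (g : GL (Fin 3) F) : GL (Fin 3) F ⧸ (Subgroup.zpowers (Units.mk0 ϖ hϖ0)).map (Matrix.GeneralLinearGroup.scalar (Fin 3))) :=
    QuotientGroup.continuous_mk.comp continuous_subtype_val
  have hopen : IsOpenMap fun g : {g : GL (Fin 3) F | WithZero.log (Valued.v (g : Matrix (Fin 3) (Fin 3) F).det) ∈ Set.Icc (-2 : ℤ) 0} =>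
      (QuotientGroup.mk (g : GL (Fin 3) F) : GL (Fin 3) F ⧸ (Subgroup.zpowers (Units.mk0 ϖ hϖ0)).map (Matrix.GeneralLinearGroup.scalar (Fin 3))) :=
    (QuotientGroup.isOpenMap_coe (N := (Subgroup.zpowers (Units.mk0 ϖ hϖ0)).map (Matrix.GeneralLinearGroup.scalar (Fin 3)))).comp
      (isClopen_preimage_log_v_det hϖ (Set.Icc (-2 : ℤ) 0)).isOpen.isOpenMap_subtype_val
  exact ⟨(Equiv.ofBijective _ hbij).toHomeomorphOfContinuousOpen hcont hopen, fun g => rfl⟩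

/-- **`D ∩ mk⁻¹(K)` is compact for every compact `K ⊆ G'`** (pull `K` back through the homeomorphism `D ≃ₜ G'`). [cite: WeilIntegration1965, §7] -/
theorem isCompact_inter_preimage_mk {ϖ : F} (hϖ : Valued.v ϖ = WithZero.exp (-1 : ℤ)) (hϖ0 : ϖ ≠ 0)
    [((Subgroup.zpowers (Units.mk0 ϖ hϖ0)).map (Matrix.GeneralLinearGroup.scalar (Fin 3))).Normal]
    {K : Set (GL (Fin 3) F ⧸ (Subgroup.zpowers (Units.mk0 ϖ hϖ0)).map (Matrix.GeneralLinearGroup.scalar (Fin 3)))} (hK : IsCompact K) :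
    IsCompact ({g : GL (Fin 3) F | WithZero.log (Valued.v (g : Matrix (Fin 3) (Fin 3) F).det) ∈ Set.Icc (-2 : ℤ) 0} ∩
      (QuotientGroup.mk : GL (Fin 3) F → GL (Fin 3) F ⧸ (Subgroup.zpowers (Units.mk0 ϖ hϖ0)).map (Matrix.GeneralLinearGroup.scalar (Fin 3))) ⁻¹' K) := by
  obtain ⟨e, he⟩ := exists_homeomorph_fundDomain hϖ hϖ0
  have h : {g : GL (Fin 3) F | WithZero.log (Valued.v (g : Matrix (Fin 3) (Fin 3) F).det) ∈ Set.Icc (-2 : ℤ) 0} ∩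
      (QuotientGroup.mk : GL (Fin 3) F → GL (Fin 3) F ⧸ (Subgroup.zpowers (Units.mk0 ϖ hϖ0)).map (Matrix.GeneralLinearGroup.scalar (Fin 3))) ⁻¹' K =
        Subtype.val '' (e ⁻¹' K) := by
    have hpre : (e : _ → GL (Fin 3) F ⧸ (Subgroup.zpowers (Units.mk0 ϖ hϖ0)).map (Matrix.GeneralLinearGroup.scalar (Fin 3))) ⁻¹' K =
        Subtype.val ⁻¹' ((QuotientGroup.mk : GL (Fin 3) F → _) ⁻¹' K) := by
      ext g
      simp only [Set.mem_preimage, he]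
    rw [hpre, Subtype.image_preimage_coe]
  rw [h]
  exact (e.isCompact_preimage.2 hK).image continuous_subtype_val

end Topology

end Summit.HodgeConjecture.HodgeConjecture.Cruxes.H413.K2E3GL3ModUniformizerFundamentalDomain
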